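import Literature.Topology.FourManifolds.FishtailDZeroZones
import Literature.Topology.FourManifolds.FishtailPolarForm
import Literature.Topology.FourManifolds.FishtailCapEndPoints
import Literature.Topology.FourManifolds.SurgeredInl
import HarnessLib

/-!
# The tube over the north cap of Gompf's disc, in the cap chart

Infrastructure for the explicit fishtail neighbourhood (R. Gompf, *More Cappell–Shaneson spheres
are standard*, Algebr. Geom. Topol. 10 (2010), proof of Thm 2.1 and Lemma 2.2; the named fact
`Literature.Topology.FourManifolds.gompf2010_framedTwist`). The part `D⁰` of Gompf's disc
contains the whole north cap of the surgered section sphere. Over a point `d` of the (extended)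
cap chart the tube is, according to `‖d‖`:

* `‖d‖ < 1/2`: the product chart of the new piece (`capEndN`, `FishtailCapEnd.lean`);
* `1/2 ≤ ‖d‖ < 13/20`: the rescaling `zoneN2` (sphere form `κ(n₀) = c n₀` → constant `λ`);
* `13/20 ≤ ‖d‖ < 4/5`: the frame switch `zoneN3` (sphere form → vertical tube);
* `4/5 ≤ ‖d‖`: the tube of the north chart `zoneN4` (vertical frame, section `σ_C`, the puncture),

* `RM ≤ ‖d‖`: the flat-annulus zone `zoneM` (beyond the puncture's latitude, `σ_far`),

glued by `glueBy ‖d‖` (`FishtailPolarForm.lean`) into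
`Literature.Topology.FourManifolds.tubeD0N`, the latitude–base zones being read in the chart by
`polarForm` and in `X^σ` by `toSurg`. This file proves the three agreements on the slabs
(`pieceN1_eq_pieceN2`, `pieceN2_eq_pieceN3`, `pieceN3_eq_pieceN4`, `pieceN4_eq_pieceM`) under the plateau
hypotheses on `κ`, `μ`, `σ_C`, and the local diffeomorphism property of `tubeD0N`
(`isLocalDiffeomorphAt_tubeD0N`). Everything is proved; no named facts.

## References

* R. E. Gompf, *More Cappell–Shaneson spheres are standard*, Algebr. Geom. Topol. 10 (2010)
  1665–1681, proof of Thm 2.1 and Lemma 2.2. [GompfAGT2010]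
-/

noncomputable section

open scoped Real ContDiff Topology Manifold
open Set Function Filter Complex Metric

namespace Literature.Topology.FourManifolds

local notation "𝔼 " n:arg => EuclideanSpace ℝ (Fin n)

/-! ### The surgered mapping torus of the tube shear -/

section Nu

variable {ε : ℝ} (hε : 0 < ε) (hε2 : ε ≤ 1 / 2)

/-- `ε ≤ 1/2 ≤ π`. [folklore] -/
theorem le_pi_of_le_half (hε2 : ε ≤ 1 / 2) : ε ≤ π := by linarith [Real.pi_gt_three]

/-- The tube shear fixes `expT v` for `‖v‖ < ε ≤ 1/2`. [folklore] -/
theorem tubeShearDiffeo_expT (hε2 : ε ≤ 1 / 2) : ∀ v : 𝔼 3, ‖v‖ < ε → tubeShearDiffeo (expT v) = expT v :=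
  fun _ hv ↦ tubeShear_expT_of_norm_lt (hv.trans_le hε2)

/-- **The product tube of the section circle of `X_{tubeShear}`** of radius `ε ≤ 1/2`. [folklore] -/
abbrev fishNu : CircleNbhd (𝓡 4) (prodPair tubeShearDiffeo ε hε (le_pi_of_le_half hε2) (tubeShearDiffeo_expT hε2)).secCircle :=
  prodTube tubeShearDiffeo ε hε (le_pi_of_le_half hε2) (tubeShearDiffeo_expT hε2)

/-- `tubeShear 1 = 1`. [folklore] -/
theorem tubeShearDiffeo_one : tubeShearDiffeo (1 : ThreeTorus) = 1 := by
  have h := tubeShear_expT_of_norm_lt (v := 0) (by simp)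
  have h1 : expT (0 : 𝔼 3) = 1 := by
    refine Prod.ext ?_ (Prod.ext ?_ ?_) <;> simp [expT]
  rw [h1] at h
  exact h

/-- **A mapping-torus point `[x, s]`, `x ≠ 1`, `0 < s < 3/2`, lies off the section circle.** [folklore] -/
theorem mtPt_mem_complement {x : ThreeTorus} (hx : x ≠ 1) {s : ℝ} (hs0 : 0 < s) (hs1 : s < 3 / 2) :
    mtPt tubeShearDiffeo x s ∈ (fishNu hε hε2).complement := by
  rw [CircleNbhd.mem_complement_iff]
  intro h
  exact hx ((mtPt_mem_range_secCircle_iff (P := prodPair tubeShearDiffeo ε hε (le_pi_of_le_half hε2)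
    (tubeShearDiffeo_expT hε2)) tubeShearDiffeo_one hs0 hs1).1 h)

/-- `expT v ≠ 1` as soon as `v₁ ∉ 2πℤ`; here from `0 < |v₀| < 2π`. [folklore] -/
theorem expT_ne_one_of_fst {v : 𝔼 3} (h0 : v 0 ≠ 0) (h1 : |v 0| < 2 * π) : expT v ≠ 1 := by
  intro h
  have h' : (expT v).1 = 1 := by rw [h]; rfl
  simp only [expT] at h'
  rw [Circle.exp_eq_one] at h'
  obtain ⟨m, hm⟩ := h'
  have hπ := Real.pi_pos
  rcases lt_trichotomy m 0 with hneg | hzero | hpos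
  · have : (m : ℝ) ≤ -1 := by exact_mod_cast Int.le_sub_one_iff.2 hneg
    have := (abs_lt.1 h1).1; nlinarith
  · rw [hzero] at hm; simp at hm; exact h0 hm
  · have : (1 : ℝ) ≤ m := by exact_mod_cast hpos
    have := (abs_lt.1 h1).2; nlinarith

end Nu

/-! ### The pieces -/

section Pieces

variable {ε : ℝ} (hε : 0 < ε) (hε2 : ε ≤ 1 / 2) (tj δ r₁ r₂ r₃ lam cN : ℝ) (kapN μN : ℝ → ℝ)

/-- Piece 1: the product chart of the new piece at the north cap centre. [folklore] -/
def pieceN1 (q : ℂ × ℝ × ℝ) : (fishNu hε hε2).Surgered := capEndN (fishNu hε hε2) cN q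

/-- Piece 2: the rescaling zone read in the chart and in `X^σ`. [folklore] -/
def pieceN2 (q : ℂ × ℝ × ℝ) : (fishNu hε hε2).Surgered := toSurg (fishNu hε hε2) (polarForm ε (zoneN2 kapN) q)

/-- Piece 3: the switch zone. [folklore] -/
def pieceN3 (q : ℂ × ℝ × ℝ) : (fishNu hε hε2).Surgered := toSurg (fishNu hε hε2) (polarForm ε (zoneN3 μN lam) q)

/-- Piece 4: the north chart zone. [folklore] -/
def pieceN4 (q : ℂ × ℝ × ℝ) : (fishNu hε hε2).Surgered :=
  toSurg (fishNu hε hε2) (polarForm ε (zoneN4 ε tj δ r₁ r₂ r₃ lam) q)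

variable (c RM : ℝ)

/-- Piece 5: the flat-annulus zone (beyond the puncture's latitude), read in the chart. [folklore] -/
def pieceM (q : ℂ × ℝ × ℝ) : (fishNu hε hε2).Surgered := toSurg (fishNu hε hε2) (polarForm ε (zoneM δ lam c) q)

/-- **The tube over the north part of `D⁰`**, glued along `‖d‖` at `1/2`, `13/20`, `4/5`, `RM`. [folklore] -/
def tubeD0N : ℂ × ℝ × ℝ → (fishNu hε hε2).Surgered :=
  glueBy (fun q ↦ ‖q.1‖) (1 / 2) (pieceN1 hε hε2 cN)
    (glueBy (fun q ↦ ‖q.1‖) (13 / 20) (pieceN2 hε hε2 kapN)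
      (glueBy (fun q ↦ ‖q.1‖) (4 / 5) (pieceN3 hε hε2 lam μN)
        (glueBy (fun q ↦ ‖q.1‖) RM (pieceN4 hε hε2 tj δ r₁ r₂ r₃ lam) (pieceM hε hε2 δ lam c))))

variable {tj δ r₁ r₂ r₃ lam cN kapN μN c RM}

/-! #### Chart identities -/

include hε in
/-- `capPt ε (capN ε d) (baseOf d) = d` (both branches of `baseOf`). [folklore] -/
theorem capPt_capN_baseOf (d : ℂ) : capPt ε (capN ε d) (baseOf d) = d := by
  rcases lt_or_ge d.re 0 with h | h
  · rw [baseOf_of_neg h, capPt, capN, capRad_capLat hε]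
    have hd : d ≠ 0 := fun h0 ↦ by rw [h0] at h; simp at h
    have h2 : (2 * (π : ℂ) * ((arg (-d) / (2 * π) + 1 / 2 : ℝ) : ℂ) * I) = (arg (-d) : ℂ) * I + π * I := by
      push_cast; field_simp
    rw [h2, Complex.exp_add, exp_pi_mul_I]
    have := norm_mul_exp_arg_mul_I (-d)
    rw [norm_neg] at this
    linear_combination -this
  · rw [baseOf_of_nonneg h]
    exact capPt_capN_capS hε d

/-- `-capN ε d = ε ‖d‖/√(1 + ‖d‖²) ≥ 0`, `< ε`, and `> 0` for `d ≠ 0`. [folklore] -/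
theorem neg_capN_eq (d : ℂ) : -capN ε d = ε * ‖d‖ / Real.sqrt (1 + ‖d‖ ^ 2) := by
  rw [capN, capLat]; ring

include hε in
/-- `0 < -capN ε d` for `d ≠ 0`. [folklore] -/
theorem neg_capN_pos {d : ℂ} (hd : d ≠ 0) : 0 < -capN ε d := by
  rw [neg_capN_eq]; exact div_pos (mul_pos hε (norm_pos_iff.2 hd)) (Real.sqrt_pos.2 (by positivity))

include hε in
/-- `-capN ε d ≤ ε ‖d‖` (so `< 1/2` when `‖d‖ < 1`, `ε ≤ 1/2`). [folklore] -/
theorem neg_capN_le (d : ℂ) : -capN ε d ≤ ε * ‖d‖ := by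
  rw [neg_capN_eq, div_le_iff₀ (Real.sqrt_pos.2 (by positivity))]
  have h1 : 1 ≤ Real.sqrt (1 + ‖d‖ ^ 2) := Real.one_le_sqrt.2 (by nlinarith [norm_nonneg d])
  nlinarith [mul_nonneg hε.le (norm_nonneg d)]

/-! #### Agreement of pieces 1 and 2 -/

/-- The rescaling depends on `κ` only through `κ(n₀)`. [folklore] -/
theorem scaleRealN_congr {kap kap' : ℝ → ℝ} {q : ℝ × ℝ × ℝ × ℝ} (h : kap q.1 = kap' q.1) :
    scaleRealN kap q = scaleRealN kap' q := by
  simp [scaleRealN, scaleReal, h]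

/-- **Pieces 1 and 2 agree** where `0 < ‖d‖ < 1`, the offsets are chart-admissible
(`(c a)² + (c b)² < 1`) and the scale is the cone `κ(n₀) = c n₀` at `n₀ = -capN ε d`. [folklore] -/
theorem pieceN1_eq_pieceN2 {q : ℂ × ℝ × ℝ} (h0 : q.1 ≠ 0) (h1 : ‖q.1‖ < 1)
    (hadm : (cN * q.2.1) ^ 2 + (cN * q.2.2) ^ 2 < 1) (hcone : kapN (-capN ε q.1) = cN * (-capN ε q.1)) :
    pieceN1 hε hε2 cN q = pieceN2 hε hε2 kapN q := by
  -- piece 1 through the old piece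
  rw [pieceN1, capEndN_eq_inl (ν := fishNu hε hε2) h1 h0]
  -- piece 2 as a mapping-torus point
  have hn0 : 0 ≤ -capN ε q.1 := (neg_capN_pos hε h0).le
  have hV : (scaleRealN kapN (-capN ε q.1, baseOf (exp (arg q.1 * I)), q.2)).1 =
      (-capN ε q.1) • reflX (thetaVec (cN * q.2.1, cN * q.2.2)) := by
    rw [smul_reflX_thetaVec hn0, scaleRealN_apply]
    simp only [hcone]
    ext j; fin_cases j
    · simp only [Fin.zero_eta, Matrix.cons_val_zero, neg_inj, sphX]
      congr 1; ring
    · simp; ring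
    · simp; ring
  have hX : polarForm ε (zoneN2 kapN) q =
      mtPt tubeShearDiffeo (expT ((-capN ε q.1) • reflX (thetaVec (cN * q.2.1, cN * q.2.2)))) (baseOf q.1) := by
    rw [polarForm_apply, zoneN2_apply, mtCoord, hV]
    simp only
    rw [baseOf_exp_arg h0]
    rfl
  have hX' : polarForm ε (zoneN2 kapN) q =
      ((fishNu hε hε2).bwdA (toE2 q.1, reflS (thetaPt (cN * q.2.1, cN * q.2.2))) : MTorus tubeShearDiffeo) := by
    rw [hX, coe_capEndN_point tubeShearDiffeo hε (le_pi_of_le_half hε2) (tubeShearDiffeo_expT hε2) h0,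
      coe_reflS_thetaPt (by simpa using hadm)]
    rfl
  rw [pieceN2, toSurg_eq_inl (by rw [hX']; exact ((fishNu hε hε2).bwdA _).2)]
  congr 1
  exact Subtype.ext hX'.symm

/-! #### Agreement of pieces 2 and 3 -/

/-- **Pieces 2 and 3 agree** where `μ(n₀) = 0` and `κ(n₀) = λ`, `n₀ = -capN ε d`. [folklore] -/
theorem pieceN2_eq_pieceN3 {q : ℂ × ℝ × ℝ} (hμ : μN (-capN ε q.1) = 0) (hk : kapN (-capN ε q.1) = lam) :
    pieceN2 hε hε2 kapN q = pieceN3 hε hε2 lam μN q := by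
  simp only [pieceN2, pieceN3, polarForm_apply, zoneN2_apply, zoneN3_apply]
  rw [switchXRealN_of_mu_zero (by exact hμ), scaleRealN_congr (kap' := fun _ ↦ lam) (by exact hk)]

/-! #### Agreement of pieces 3 and 4 -/

/-- **Pieces 3 and 4 agree** where `μ(n₀) = 1` (`n₀ = -capN ε d`) and `σ_C(d) = 1`. [folklore] -/
theorem pieceN3_eq_pieceN4 {q : ℂ × ℝ × ℝ} (hμ : μN (-capN ε q.1) = 1) (hσ : sigmaCapC tj δ r₁ r₂ r₃ q.1 = 1) :
    pieceN3 hε hε2 lam μN q = pieceN4 hε hε2 tj δ r₁ r₂ r₃ lam q := by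
  simp only [pieceN3, pieceN4, polarForm_apply, zoneN3_apply, zoneN4_apply, mtCoord]
  rw [switchXRealN_of_mu_one (by exact hμ)]
  have hd : capPt ε (capN ε q.1) (baseOf (exp (arg q.1 * I))) = q.1 := by
    by_cases h0 : q.1 = 0
    · rw [h0, capN, norm_zero, capPt]
      simp [capRad, capLat]
    · rw [baseOf_exp_arg h0, capPt_capN_baseOf hε]
  rw [hd]
  -- the two `T³` points
  have hz : northZ3 tj δ r₁ r₂ r₃ lam q.1 q.2.2 = Circle.exp (-(lam * q.2.2)) := by rw [northZ3, hσ, one_mul]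
  have hx : expT (WithLp.toLp 2 ![-(-capN ε q.1) + lam * q.2.2, lam * q.2.1, -(lam * q.2.2)]) =
      northT3 ε tj δ r₁ r₂ r₃ lam q.1 q.2.1 q.2.2 := by
    simp only [northT3, hz, expT]
    refine Prod.ext ?_ (Prod.ext ?_ ?_)
    · show Circle.exp _ = Circle.exp (capN ε q.1) * (Circle.exp (-(lam * q.2.2)))⁻¹
      rw [← Circle.exp_neg, ← Circle.exp_add]
      congr 1; simp
    · simp
    · simp
  simp only at hx ⊢
  rw [hx]

/-! #### Agreement of pieces 4 and 5 -/

/-- `capS d = baseOf d` or `capS d = baseOf d + 1` (the latter with `baseOf d ∈ (1/4, 1/2]`). [folklore] -/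
theorem capS_eq_baseOf_or (d : ℂ) : capS d = baseOf d ∨ (capS d = baseOf d + 1 ∧ baseOf d ≤ 1 / 2) := by
  have hπ := Real.pi_pos
  rcases lt_or_ge d.re 0 with h | h
  · rw [baseOf_of_neg h, capS]
    rcases lt_trichotomy d.im 0 with him | him | him
    · left; rw [arg_neg_eq_arg_add_pi_of_im_neg him]; field_simp; ring
    · right
      have hd : d = ((d.re : ℝ) : ℂ) := Complex.ext (by simp) (by simp [him])
      have h1 : arg d = π := by rw [hd]; exact arg_ofReal_of_neg h
      have h2 : arg (-d) = 0 := by rw [hd, ← ofReal_neg]; exact arg_ofReal_of_nonneg (by linarith)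
      rw [h1, h2]; constructor
      · field_simp; ring
      · simp
    · right
      rw [arg_neg_eq_arg_sub_pi_of_im_pos him]
      have ha : arg d ≤ π := arg_le_pi d
      constructor
      · field_simp; ring
      · have : (arg d - π) / (2 * π) ≤ 0 := div_nonpos_of_nonpos_of_nonneg (by linarith) (by positivity)
        linarith
  · left; rw [baseOf_of_nonneg h, capS, add_comm]

/-- The step only matters through `e^{2πi sStep}`: `e^{2πi sStep (capS d)} = e^{2πi sStep (baseOf d)}`
for `0 < δ ≤ 1/4`. [folklore] -/
theorem circleExp_sStep_capS (hδ : 0 < δ) (hδ' : δ ≤ 1 / 4) (d : ℂ) (t : ℝ) :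
    Circle.exp (sStep δ (capS d) * (2 * π) + t) = Circle.exp (sStep δ (baseOf d) * (2 * π) + t) := by
  rcases capS_eq_baseOf_or d with h | ⟨h, hb⟩
  · rw [h]
  · rw [h, sStep_of_ge hδ (by linarith [(baseOf_mem d).1]), sStep_of_le hδ (by linarith)]
    simp only [one_mul, zero_mul, zero_add, Circle.exp_add, Circle.exp_two_pi]

/-- **Pieces 4 and 5 agree** beyond the puncture's latitude and blend annulus: for `d` with
`tj < ‖d‖`, `r₂ ≤ ‖d - d₀‖`, `0 < r₁ < r₂`, `0 < δ ≤ 1/4`, and cut `c` with `capN ε d ≤ c`,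
`c < capN ε d + 2π`, `1 ≤ capN ε d + 2π - 1`. [folklore] -/
theorem pieceN4_eq_pieceM (h1r : 0 < r₁) (h12 : r₁ < r₂) (hδ : 0 < δ) (hδ' : δ ≤ 1 / 4) {q : ℂ × ℝ × ℝ}
    (h0 : q.1 ≠ 0) (htj : tj < ‖q.1‖) (hfar : r₂ ≤ ‖q.1 - dCenter tj‖) (hc1 : capN ε q.1 ≤ c)
    (hc2 : c < capN ε q.1 + 2 * π) (hn2 : 2 ≤ capN ε q.1 + 2 * π) :
    pieceN4 hε hε2 tj δ r₁ r₂ r₃ lam q = pieceM hε hε2 δ lam c q := by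
  simp only [pieceN4, pieceM, polarForm_apply, zoneN4_apply, zoneM_apply]
  rw [baseOf_exp_arg h0, capPt_capN_baseOf hε]
  congr 1
  -- sections: `σ_C(d) = σ_out(d) = e^{2πi sStep(capS d)}` and `σ_far(e^{in}, s) = sStep(s)·2π`
  have hσ : sigmaCapC tj δ r₁ r₂ r₃ q.1 = Circle.exp (2 * π * sStep δ (capS q.1)) := by
    rw [sigmaCapC_of_le_norm h1r h12 hfar, sigmaOutC, gOut, if_pos htj, sStepD, capS]; ring_nf
  have hfarσ : sigmaFar c δ (Circle.exp (capN ε q.1)) (baseOf q.1) = sStep δ (baseOf q.1) * (2 * π) := by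
    have e : Circle.exp (capN ε q.1) = Circle.exp (capN ε q.1 + 2 * π) := by
      rw [Circle.exp_add, Circle.exp_two_pi, mul_one]
    rw [e, sigmaFar_exp (by linarith) (by linarith), Real.smoothTransition.one_of_one_le (by linarith), mul_one]
  have hz : northZ3 tj δ r₁ r₂ r₃ lam q.1 q.2.2 = Circle.exp (midEll c δ lam (capN ε q.1) (baseOf q.1) q.2.2) := by
    rw [northZ3, hσ, midEll, hfarσ, ← Circle.exp_add, sub_eq_add_neg, show 2 * π * sStep δ (capS q.1) =
      sStep δ (capS q.1) * (2 * π) by ring]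
    exact circleExp_sStep_capS hδ hδ' q.1 _
  simp only [northT3, midT3, hz]

/-! #### Local diffeomorphism -/

variable (hlam : lam ≠ 0)

/-- Periodicity of the zones in the angle (for `polarForm`). [folklore] -/
theorem zoneN2_add_two_pi (q : ℝ × ℝ × ℝ × ℝ) : zoneN2 kapN (q.1, q.2.1 + 2 * π, q.2.2) = zoneN2 kapN q :=
  twoChart_add_two_pi q

/-- Periodicity of the switch zone in the angle. [folklore] -/
theorem zoneN3_add_two_pi (q : ℝ × ℝ × ℝ × ℝ) : zoneN3 μN lam (q.1, q.2.1 + 2 * π, q.2.2) = zoneN3 μN lam q :=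
  twoChart_add_two_pi q

/-- Periodicity of the north chart zone in the angle. [folklore] -/
theorem zoneN4_add_two_pi (q : ℝ × ℝ × ℝ × ℝ) :
    zoneN4 ε tj δ r₁ r₂ r₃ lam (q.1, q.2.1 + 2 * π, q.2.2) = zoneN4 ε tj δ r₁ r₂ r₃ lam q :=
  twoChart_add_two_pi q

/-- **Piece 2 is a local diffeomorphism** at `(d, a, b)`, `d ≠ 0`, `n₀ = -capN ε d < 1/2`, `κ` smooth,
`κ(n₀) ≠ 0`, strictly admissible offsets (`(κ a)² + (κ b)² < n₀²`). [folklore] -/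
theorem isLocalDiffeomorphAt_pieceN2 (hkap : ContDiff ℝ ∞ kapN) {q : ℂ × ℝ × ℝ} (h0 : q.1 ≠ 0)
    (hn1 : -capN ε q.1 < 1 / 2) (hk : kapN (-capN ε q.1) ≠ 0)
    (hadm : (kapN (-capN ε q.1) * q.2.1) ^ 2 + (kapN (-capN ε q.1) * q.2.2) ^ 2 < (-capN ε q.1) ^ 2) :
    IsLocalDiffeomorphAt 𝓘(ℝ, ℂ × ℝ × ℝ) 𝓘(ℝ, 𝔼 4) ∞ (pieceN2 hε hε2 kapN) q := by
  have hn : 0 < -capN ε q.1 := neg_capN_pos hε h0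
  have hP : IsLocalDiffeomorphAt 𝓘(ℝ, ℂ × ℝ × ℝ) 𝓘(ℝ, 𝔼 4) ∞ (polarForm ε (zoneN2 kapN)) q :=
    isLocalDiffeomorphAt_polarForm hε (fun n ϑ w ↦ zoneN2_add_two_pi (n, ϑ, w)) h0
      fun ϑ ↦ isLocalDiffeomorphAt_zoneN2 hkap (q := (capN ε q.1, ϑ, q.2)) hn hn1 hk hadm
  -- the value lies off the section circle
  have hmem : polarForm ε (zoneN2 kapN) q ∈ (fishNu hε hε2).complement := by
    rw [polarForm_apply, zoneN2_apply, mtCoord]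
    refine mtPt_mem_complement hε hε2 (expT_ne_one_of_fst ?_ ?_) (baseOf_mem' _).1 (baseOf_mem' _).2
    · -- `v₀ = -√(n₀² - …) < 0`
      rw [scaleRealN_apply]
      simp only [Matrix.cons_val_zero, neg_ne_zero, sphX]
      refine (Real.sqrt_pos.2 ?_).ne'
      nlinarith [hadm]
    · have hb := abs_sum_scaleRealN (kapN := kapN) (q := (-capN ε q.1, baseOf (exp (arg q.1 * I)), q.2)) hn.le hadm.le
      -- `|v₀| ≤ n₀ < 1/2 < 2π`; from `v₀ ∈ [-n₀, 0]`
      rw [scaleRealN_apply]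
      simp only [Matrix.cons_val_zero, abs_neg, sphX]
      rw [abs_of_nonneg (Real.sqrt_nonneg _)]
      have : Real.sqrt ((-capN ε q.1) ^ 2 - (kapN (-capN ε q.1) * q.2.1) ^ 2 - (kapN (-capN ε q.1) * -q.2.2) ^ 2)
          ≤ -capN ε q.1 := by
        rw [Real.sqrt_le_left hn.le]; nlinarith
      linarith [Real.pi_gt_three]
  have hT := isLocalDiffeomorphAt_toSurg (ν := fishNu hε hε2) hmem
  exact hP.comp (K := 𝓘(ℝ, 𝔼 4)) (P := (fishNu hε hε2).Surgered) hT

/-- **Piece 1 is a local diffeomorphism** at `(d, a, b)`, `‖d‖ < 1`, `c ≠ 0`, `(c a)² + (c b)² < 1`. [folklore] -/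
theorem isLocalDiffeomorphAt_pieceN1 (hc : cN ≠ 0) {q : ℂ × ℝ × ℝ} (h1 : ‖q.1‖ < 1)
    (hadm : (cN * q.2.1) ^ 2 + (cN * q.2.2) ^ 2 < 1) :
    IsLocalDiffeomorphAt 𝓘(ℝ, ℂ × ℝ × ℝ) 𝓘(ℝ, 𝔼 4) ∞ (pieceN1 hε hε2 cN) q :=
  isLocalDiffeomorphAt_capEndN (fishNu hε hε2) hc h1 hadm

/-- The switch abscissa is positive for `0 ≤ μ ≤ 1`, `|κ b| < n₀` and strictly admissible offsets. [folklore] -/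
theorem switchX_pos {μ : ℝ → ℝ} {kap n₀ a b : ℝ} (hμ0 : 0 ≤ μ n₀) (hμ1 : μ n₀ ≤ 1)
    (hadm : (kap * a) ^ 2 + (kap * b) ^ 2 < n₀ ^ 2) (hb : |kap * b| < n₀) : 0 < switchX μ kap n₀ a b := by
  unfold switchX sphX
  have hs : 0 < Real.sqrt (n₀ ^ 2 - (kap * a) ^ 2 - (kap * b) ^ 2) := Real.sqrt_pos.2 (by nlinarith)
  have hb' : 0 < n₀ + kap * b := by linarith [neg_abs_le (kap * b)]
  rcases hμ0.lt_or_eq with hpos | hzero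
  · nlinarith [mul_pos hpos hb', mul_nonneg (sub_nonneg.2 hμ1) hs.le]
  · rw [← hzero]; simpa using hs

/-- **Piece 3 is a local diffeomorphism** at `(d, a, b)`, `d ≠ 0`, `n₀ = -capN ε d < 1/2`, `μ` smooth
with `0 ≤ μ ≤ 1`, `λ ≠ 0`, strictly admissible offsets, `|λ b| < min (1/4) n₀`, and nonvanishing
`n₀`-derivative of the (mirrored) switch abscissa. [folklore] -/
theorem isLocalDiffeomorphAt_pieceN3 (hμ : ContDiff ℝ ∞ μN) (hμ01 : ∀ n, 0 ≤ μN n ∧ μN n ≤ 1) (hlam : lam ≠ 0)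
    {q : ℂ × ℝ × ℝ} (h0 : q.1 ≠ 0) (hn1 : -capN ε q.1 < 1 / 2)
    (hadm : (lam * q.2.1) ^ 2 + (lam * q.2.2) ^ 2 < (-capN ε q.1) ^ 2) (hb4 : |lam * q.2.2| < 1 / 4)
    (hbn : |lam * q.2.2| < -capN ε q.1)
    (hder : -deriv μN (-capN ε q.1) * sphX (-capN ε q.1) (lam * q.2.1) (lam * -q.2.2) +
        (1 - μN (-capN ε q.1)) * ((-capN ε q.1) / Real.sqrt ((-capN ε q.1) ^ 2 - (lam * q.2.1) ^ 2 - (lam * -q.2.2) ^ 2)) +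
        (deriv μN (-capN ε q.1) * ((-capN ε q.1) + lam * -q.2.2) + μN (-capN ε q.1) * 1) ≠ 0) :
    IsLocalDiffeomorphAt 𝓘(ℝ, ℂ × ℝ × ℝ) 𝓘(ℝ, 𝔼 4) ∞ (pieceN3 hε hε2 lam μN) q := by
  have hn : 0 < -capN ε q.1 := neg_capN_pos hε h0
  have hP : IsLocalDiffeomorphAt 𝓘(ℝ, ℂ × ℝ × ℝ) 𝓘(ℝ, 𝔼 4) ∞ (polarForm ε (zoneN3 μN lam)) q := by
    refine isLocalDiffeomorphAt_polarForm' hε (fun n ϑ w ↦ zoneN3_add_two_pi (n, ϑ, w)) h0 ?_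
    exact isLocalDiffeomorphAt_zoneN3 hμ hμ01 hlam (q := (capN ε q.1, arg q.1, q.2)) (by simpa using hn)
      (by simpa using hn1) (by simpa using hadm) (by simpa using hb4) (by simpa using hder)
  have hmem : polarForm ε (zoneN3 μN lam) q ∈ (fishNu hε hε2).complement := by
    rw [polarForm_apply, zoneN3_apply, mtCoord]
    have hsw := switchX_pos (μ := μN) (kap := lam) (n₀ := -capN ε q.1) (a := q.2.1) (b := -q.2.2)
      (hμ01 _).1 (hμ01 _).2 (by simpa using hadm) (by simpa using hbn)
    refine mtPt_mem_complement hε hε2 (expT_ne_one_of_fst ?_ ?_) (baseOf_mem' _).1 (baseOf_mem' _).2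
    · show (switchXRealN μN lam (-capN ε q.1, baseOf (exp (arg q.1 * I)), q.2)).1 0 ≠ 0
      rw [switchXRealN, mirrorL_apply]
      simp only [Matrix.cons_val_zero, neg_ne_zero]
      show (switchXReal μN lam (negB (-capN ε q.1, baseOf (exp (arg q.1 * I)), q.2))).1 0 ≠ 0
      simp only [negB_apply, switchXReal, Matrix.cons_val_zero]
      exact hsw.ne'
    · -- `|v₀| = switchX ≤ n₀ + |λ b| < 3/4 < 2π`
      rw [switchXRealN, mirrorL_apply]
      simp only [Matrix.cons_val_zero, abs_neg]
      show |(switchXReal μN lam (negB (-capN ε q.1, baseOf (exp (arg q.1 * I)), q.2))).1 0| < 2 * π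
      simp only [negB_apply, switchXReal, Matrix.cons_val_zero]
      rw [abs_of_pos hsw, switchX]
      have hS : sphX (-capN ε q.1) (lam * q.2.1) (lam * -q.2.2) ≤ -capN ε q.1 := by
        rw [sphX, Real.sqrt_le_left hn.le]; nlinarith
      have hS0 : 0 ≤ sphX (-capN ε q.1) (lam * q.2.1) (lam * -q.2.2) := Real.sqrt_nonneg _
      have h1 := (hμ01 (-capN ε q.1)).1
      have h2 := (hμ01 (-capN ε q.1)).2
      have hbb : lam * -q.2.2 ≤ 1 / 4 := by have := le_abs_self (lam * q.2.2); rw [abs_lt] at hb4; nlinarith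
      nlinarith [Real.pi_gt_three, mul_le_mul_of_nonneg_left hS (sub_nonneg.2 h2),
        mul_le_mul_of_nonneg_left (show -capN ε q.1 + lam * -q.2.2 ≤ 3 / 4 by linarith) h1]
  exact hP.comp (K := 𝓘(ℝ, 𝔼 4)) (P := (fishNu hε hε2).Surgered) (isLocalDiffeomorphAt_toSurg (ν := fishNu hε hε2) hmem)

include hε in
/-- The north chart `T³` point is never `1` (`z₁ z₃ = e^{i capN d}` with `-ε < capN d < 0`). [folklore] -/
theorem northT3_ne_one (hεπ : ε < π) {d : ℂ} (hd : d ≠ 0) (a b : ℝ) : northT3 ε tj δ r₁ r₂ r₃ lam d a b ≠ 1 := by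
  intro h
  have h13 := northT3_fst_mul (ε := ε) (tj := tj) (δ := δ) (r₁ := r₁) (r₂ := r₂) (r₃ := r₃) (lam := lam) d a b
  rw [h] at h13
  have h1 : Circle.exp (capN ε d) = 1 := by simpa using h13.symm
  rw [Circle.exp_eq_one] at h1
  obtain ⟨m, hm⟩ := h1
  have hn : 0 < -capN ε d := neg_capN_pos hε hd
  have hn' : -capN ε d < ε := by
    have := capLat_sq_lt hε ‖d‖
    rw [capN] at hn ⊢
    nlinarith
  have hπ := Real.pi_pos
  rcases lt_trichotomy m 0 with hneg | hzero | hpos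
  · have : (m : ℝ) ≤ -1 := by exact_mod_cast Int.le_sub_one_iff.2 hneg
    nlinarith
  · rw [hzero] at hm; simp at hm; linarith
  · have : (1 : ℝ) ≤ m := by exact_mod_cast hpos
    nlinarith

/-- **Piece 4 is a local diffeomorphism** at `(d, a, b)`, `d ≠ 0`, `λ ≠ 0`, `ε < π`, where `σ_C`
is smooth near `d`. [folklore] -/
theorem isLocalDiffeomorphAt_pieceN4 (hεπ : ε < π) (hlam : lam ≠ 0) {q : ℂ × ℝ × ℝ} (h0 : q.1 ≠ 0)
    (hσ : ∀ᶠ d in 𝓝 q.1, ContMDiffAt 𝓘(ℝ, ℂ) (𝓡 1) ∞ (sigmaCapC tj δ r₁ r₂ r₃) d) :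
    IsLocalDiffeomorphAt 𝓘(ℝ, ℂ × ℝ × ℝ) 𝓘(ℝ, 𝔼 4) ∞ (pieceN4 hε hε2 tj δ r₁ r₂ r₃ lam) q := by
  have hn : 0 < -capN ε q.1 := neg_capN_pos hε h0
  have hn' : -capN ε q.1 < ε := by
    have := capLat_sq_lt hε ‖q.1‖
    rw [capN] at hn ⊢
    nlinarith
  have hP : IsLocalDiffeomorphAt 𝓘(ℝ, ℂ × ℝ × ℝ) 𝓘(ℝ, 𝔼 4) ∞ (polarForm ε (zoneN4 ε tj δ r₁ r₂ r₃ lam)) q := by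
    refine isLocalDiffeomorphAt_polarForm' hε (fun n ϑ w ↦ zoneN4_add_two_pi (n, ϑ, w)) h0 ?_
    refine isLocalDiffeomorphAt_zoneN4 hε hεπ hlam (q := (capN ε q.1, arg q.1, q.2)) (by simp only; nlinarith)
      (by simp only; linarith) fun k h0' h1' ↦ ?_
    -- the chart point `capPt (capN d) (arg d/(2π) + k)` is `d` itself
    have hd : capPt ε (capN ε q.1) (arg q.1 / (2 * π) + k) = q.1 := by
      have hper : ∀ (s : ℝ) (m : ℤ), capPt ε (capN ε q.1) (s + m) = capPt ε (capN ε q.1) s := by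
        intro s m
        simp only [capPt]
        congr 1
        rw [show (2 * π * ((s + m : ℝ) : ℂ) * I) = 2 * π * s * I + m * (2 * π * I) by push_cast; ring,
          Complex.exp_add, Complex.exp_int_mul_two_pi_mul_I, mul_one]
      have := hper (arg q.1 / (2 * π) + 1) (k - 1)
      rw [show arg q.1 / (2 * π) + 1 + ((k - 1 : ℤ) : ℝ) = arg q.1 / (2 * π) + k by push_cast; ring] at this
      rw [this]
      exact capPt_capN_capS hε q.1
    simp only
    rw [hd]
    exact hσ
  have hmem : polarForm ε (zoneN4 ε tj δ r₁ r₂ r₃ lam) q ∈ (fishNu hε hε2).complement := by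
    rw [polarForm_apply, zoneN4_apply]
    refine mtPt_mem_complement hε hε2 ?_ (baseOf_mem' _).1 (baseOf_mem' _).2
    rw [baseOf_exp_arg h0, capPt_capN_baseOf hε]
    exact northT3_ne_one hε hεπ h0 _ _
  exact hP.comp (K := 𝓘(ℝ, 𝔼 4)) (P := (fishNu hε hε2).Surgered) (isLocalDiffeomorphAt_toSurg (ν := fishNu hε hε2) hmem)

/-- Off the cut, the real far section is smooth near `(n, s)` for every `s`. [folklore] -/
theorem eventually_contDiffAt_sigmaFar {n : ℝ} (hz : ((Circle.exp n : Circle) : ℂ) * exp (-((c + π : ℝ) : ℂ) * I) ∈ slitPlane)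
    (s : ℝ) : ∀ᶠ p in 𝓝 (n, s), ContDiffAt ℝ ∞ (fun p : ℝ × ℝ ↦ sigmaFar c δ (Circle.exp p.1) p.2) p := by
  have hc : Continuous fun p : ℝ × ℝ ↦ ((Circle.exp p.1 : Circle) : ℂ) * exp (-((c + π : ℝ) : ℂ) * I) :=
    ((continuous_subtype_val.comp (Circle.exp.continuous.comp continuous_fst)).mul continuous_const)
  have ho : IsOpen {p : ℝ × ℝ | ((Circle.exp p.1 : Circle) : ℂ) * exp (-((c + π : ℝ) : ℂ) * I) ∈ slitPlane} :=
    isOpen_slitPlane.preimage hc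
  filter_upwards [ho.mem_nhds (show (n, s) ∈ {p : ℝ × ℝ | _} from hz)] with p hp
  have hf : ContMDiffAt 𝓘(ℝ, ℝ × ℝ) (𝓡 1) ∞ (fun p : ℝ × ℝ ↦ Circle.exp p.1) p :=
    contMDiff_circleExp.contMDiffAt.comp p (contDiff_fst (E := ℝ) (F := ℝ)).contDiffAt.contMDiffAt
  have h1 : ContMDiffAt 𝓘(ℝ, ℝ × ℝ) 𝓘(ℝ, ℝ) ∞ (fun p : ℝ × ℝ ↦ seamLift c (Circle.exp p.1)) p :=
    ContMDiffAt.comp (g := seamLift c) (f := fun p : ℝ × ℝ ↦ Circle.exp p.1) p (contMDiffAt_seamLift hp) hf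
  have h1' : ContDiffAt ℝ ∞ (fun p : ℝ × ℝ ↦ seamLift c (Circle.exp p.1)) p := contMDiffAt_iff_contDiffAt.1 h1
  exact ((contDiff_sStep δ).contDiffAt.comp p contDiffAt_snd).mul h1'

/-- The flat-annulus `T³` point has latitude `z₁ z₃ = e^{in}`. [folklore] -/
theorem midT3_fst_mul (n s a b : ℝ) : (midT3 c δ lam n s a b).1 * (midT3 c δ lam n s a b).2.2 = Circle.exp n := by
  simp [midT3]

include hε hε2 in
/-- The flat-annulus `T³` point over the chart is never `1`. [folklore] -/
theorem midT3_capN_ne_one {d : ℂ} (hd : d ≠ 0) (s a b : ℝ) : midT3 c δ lam (capN ε d) s a b ≠ 1 := by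
  intro h
  have h13 := midT3_fst_mul (δ := δ) (lam := lam) (c := c) (capN ε d) s a b
  rw [h] at h13
  have h1 : Circle.exp (capN ε d) = 1 := by simpa using h13.symm
  rw [Circle.exp_eq_one] at h1
  obtain ⟨m, hm⟩ := h1
  have hn : 0 < -capN ε d := neg_capN_pos hε hd
  have hn' : -capN ε d < ε := by
    have := capLat_sq_lt hε ‖d‖
    rw [capN] at hn ⊢
    nlinarith
  have hπ := Real.pi_pos
  have hεπ : ε < 2 * π := by linarith [Real.pi_gt_three]
  rcases lt_trichotomy m 0 with hneg | hzero | hpos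
  · have : (m : ℝ) ≤ -1 := by exact_mod_cast Int.le_sub_one_iff.2 hneg
    nlinarith
  · rw [hzero] at hm; simp at hm; linarith
  · have : (1 : ℝ) ≤ m := by exact_mod_cast hpos
    nlinarith

/-- **Piece 5 is a local diffeomorphism** at `(d, a, b)`, `d ≠ 0`, `λ ≠ 0`, `-π < c < 1`, `0 < δ ≤ 1/4`,
when the latitude `capN ε d` is off the cut `c`. [folklore] -/
theorem isLocalDiffeomorphAt_pieceM (hc1 : -π < c) (hc2 : c < 1) (hδ : 0 < δ) (hδ' : δ ≤ 1 / 4) (hlam : lam ≠ 0)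
    {q : ℂ × ℝ × ℝ} (h0 : q.1 ≠ 0)
    (hcut : ((Circle.exp (capN ε q.1) : Circle) : ℂ) * exp (-((c + π : ℝ) : ℂ) * I) ∈ slitPlane) :
    IsLocalDiffeomorphAt 𝓘(ℝ, ℂ × ℝ × ℝ) 𝓘(ℝ, 𝔼 4) ∞ (pieceM hε hε2 δ lam c) q := by
  have hP : IsLocalDiffeomorphAt 𝓘(ℝ, ℂ × ℝ × ℝ) 𝓘(ℝ, 𝔼 4) ∞ (polarForm ε (zoneM δ lam c)) q := by
    refine isLocalDiffeomorphAt_polarForm' hε (fun n ϑ w ↦ zoneM_add_two_pi (n, ϑ, w)) h0 ?_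
    exact isLocalDiffeomorphAt_zoneM hc1 hc2 hδ hδ' hlam (q := (capN ε q.1, arg q.1, q.2))
      fun s ↦ eventually_contDiffAt_sigmaFar hcut s
  have hmem : polarForm ε (zoneM δ lam c) q ∈ (fishNu hε hε2).complement := by
    rw [polarForm_apply, zoneM_apply]
    exact mtPt_mem_complement hε hε2 (midT3_capN_ne_one hε hε2 h0 _ _ _) (baseOf_mem' _).1 (baseOf_mem' _).2
  exact hP.comp (K := 𝓘(ℝ, 𝔼 4)) (P := (fishNu hε hε2).Surgered) (isLocalDiffeomorphAt_toSurg (ν := fishNu hε hε2) hmem)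

/-! #### The glued tube -/

/-- **Plateau hypotheses of the north `D⁰` tube** (on the scale `κ`, the switch profile `μ`,
the cone constant `c`, and the section `σ_C`), as functions of the chart radius `‖d‖`. [folklore] -/
structure D0NPlateau (ε tj δ r₁ r₂ r₃ lam cN : ℝ) (kapN μN : ℝ → ℝ) (c RM : ℝ) : Prop where
  hkap : ContDiff ℝ ∞ kapN
  hμ : ContDiff ℝ ∞ μN
  hμ01 : ∀ n, 0 ≤ μN n ∧ μN n ≤ 1
  hcN : cN ≠ 0
  hlam : lam ≠ 0
  cone : ∀ d : ℂ, ‖d‖ < 53 / 100 → kapN (-capN ε d) = cN * (-capN ε d)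
  klam : ∀ d : ℂ, 62 / 100 < ‖d‖ → kapN (-capN ε d) = lam
  mu0 : ∀ d : ℂ, ‖d‖ < 68 / 100 → μN (-capN ε d) = 0
  mu1 : ∀ d : ℂ, 77 / 100 < ‖d‖ → μN (-capN ε d) = 1
  sig1 : ∀ d : ℂ, ‖d‖ < 83 / 100 → sigmaCapC tj δ r₁ r₂ r₃ d = 1
  hr1 : 0 < r₁
  hr12 : r₁ < r₂
  hδ : 0 < δ
  hδ' : δ ≤ 1 / 4
  hc1 : -π < c
  hc2 : c < 1
  hRM : 83 / 100 ≤ RM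
  far : ∀ d : ℂ, RM - 3 / 100 < ‖d‖ → tj < ‖d‖ ∧ r₂ ≤ ‖d - dCenter tj‖ ∧ capN ε d ≤ c ∧ c < capN ε d + 2 * π ∧
    2 ≤ capN ε d + 2 * π ∧ ((Circle.exp (capN ε d) : Circle) : ℂ) * exp (-((c + π : ℝ) : ℂ) * I) ∈ slitPlane

/-- **The north `D⁰` tube is a local diffeomorphism** at `(d, a, b)`, `0 < ‖d‖`, `ε < π`, under the
plateau hypotheses and the piecewise admissibility hypotheses at the point. [folklore] -/
theorem isLocalDiffeomorphAt_tubeD0N (hεπ : ε < π) (H : D0NPlateau ε tj δ r₁ r₂ r₃ lam cN kapN μN c RM)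
    {q : ℂ × ℝ × ℝ}
    (h1 : ‖q.1‖ < 53 / 100 → (cN * q.2.1) ^ 2 + (cN * q.2.2) ^ 2 < 1)
    (h2 : 47 / 100 < ‖q.1‖ → ‖q.1‖ < 68 / 100 → kapN (-capN ε q.1) ≠ 0 ∧
      (kapN (-capN ε q.1) * q.2.1) ^ 2 + (kapN (-capN ε q.1) * q.2.2) ^ 2 < (-capN ε q.1) ^ 2)
    (h3 : 62 / 100 < ‖q.1‖ → ‖q.1‖ < 83 / 100 →
      (lam * q.2.1) ^ 2 + (lam * q.2.2) ^ 2 < (-capN ε q.1) ^ 2 ∧ |lam * q.2.2| < 1 / 4 ∧ |lam * q.2.2| < -capN ε q.1 ∧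
      -deriv μN (-capN ε q.1) * sphX (-capN ε q.1) (lam * q.2.1) (lam * -q.2.2) +
        (1 - μN (-capN ε q.1)) * ((-capN ε q.1) / Real.sqrt ((-capN ε q.1) ^ 2 - (lam * q.2.1) ^ 2 - (lam * -q.2.2) ^ 2)) +
        (deriv μN (-capN ε q.1) * ((-capN ε q.1) + lam * -q.2.2) + μN (-capN ε q.1) * 1) ≠ 0)
    (h4 : 77 / 100 < ‖q.1‖ → ‖q.1‖ < RM + 3 / 100 → ∀ᶠ d in 𝓝 q.1, ContMDiffAt 𝓘(ℝ, ℂ) (𝓡 1) ∞ (sigmaCapC tj δ r₁ r₂ r₃) d) :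
    IsLocalDiffeomorphAt 𝓘(ℝ, ℂ × ℝ × ℝ) 𝓘(ℝ, 𝔼 4) ∞ (tubeD0N hε hε2 tj δ r₁ r₂ r₃ lam cN kapN μN c RM) q := by
  have hτ : Continuous fun q : ℂ × ℝ × ℝ ↦ ‖q.1‖ := continuous_norm.comp continuous_fst
  have hn1 : ∀ {d : ℂ}, ‖d‖ < 1 → -capN ε d < 1 / 2 := fun {d} hd ↦ by
    have := neg_capN_le hε d; nlinarith
  -- the agreements on the slabs (width 3/100)
  have A12 : ∀ q' : ℂ × ℝ × ℝ, |‖q'.1‖ - 1 / 2| < 3 / 100 → (cN * q'.2.1) ^ 2 + (cN * q'.2.2) ^ 2 < 1 →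
      pieceN1 hε hε2 cN q' = pieceN2 hε hε2 kapN q' := fun q' hq' hadm ↦ by
    obtain ⟨hl, hr⟩ := abs_lt.1 hq'
    have h0' : q'.1 ≠ 0 := fun h ↦ by rw [h, norm_zero] at hl; linarith
    exact pieceN1_eq_pieceN2 hε hε2 h0' (by linarith) hadm (H.cone q'.1 (by linarith))
  have A23 : ∀ q' : ℂ × ℝ × ℝ, |‖q'.1‖ - 13 / 20| < 3 / 100 → pieceN2 hε hε2 kapN q' = pieceN3 hε hε2 lam μN q' :=
    fun q' hq' ↦ by
      obtain ⟨hl, hr⟩ := abs_lt.1 hq'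
      exact pieceN2_eq_pieceN3 hε hε2 (H.mu0 q'.1 (by linarith)) (H.klam q'.1 (by linarith))
  have A34 : ∀ q' : ℂ × ℝ × ℝ, |‖q'.1‖ - 4 / 5| < 3 / 100 →
      pieceN3 hε hε2 lam μN q' = pieceN4 hε hε2 tj δ r₁ r₂ r₃ lam q' := fun q' hq' ↦ by
    obtain ⟨hl, hr⟩ := abs_lt.1 hq'
    exact pieceN3_eq_pieceN4 hε hε2 (H.mu1 q'.1 (by linarith)) (H.sig1 q'.1 (by linarith))
  have A45 : ∀ q' : ℂ × ℝ × ℝ, |‖q'.1‖ - RM| < 3 / 100 →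
      pieceN4 hε hε2 tj δ r₁ r₂ r₃ lam q' = pieceM hε hε2 δ lam c q' := fun q' hq' ↦ by
    obtain ⟨hl, hr⟩ := abs_lt.1 hq'
    obtain ⟨htj, hfar, hc1', hc2', hn2, -⟩ := H.far q'.1 (by linarith)
    have h0' : q'.1 ≠ 0 := fun h ↦ by rw [h, norm_zero] at hl; linarith [H.hRM]
    exact pieceN4_eq_pieceM hε hε2 H.hr1 H.hr12 H.hδ H.hδ' h0' htj hfar hc1' hc2' hn2
  -- the admissibility of piece 1 transported across the first slab is needed for `A12`; we glue with
  -- the agreement restricted to admissible points by shrinking: use `glueBy` on the modified pieces? No: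
  -- `glueBy_eventuallyEq` needs agreement on the whole slab. We therefore apply the germ lemma directly.
  unfold tubeD0N
  rcases le_or_gt ‖q.1‖ (47 / 100) with hA | hA
  swap
  have h0 : q.1 ≠ 0 := fun h ↦ by rw [h, norm_zero] at hA; linarith
  swap
  · -- deep inside piece 1
    have hev : glueBy (fun q : ℂ × ℝ × ℝ ↦ ‖q.1‖) (1 / 2) (pieceN1 hε hε2 cN)
        (glueBy (fun q ↦ ‖q.1‖) (13 / 20) (pieceN2 hε hε2 kapN)
          (glueBy (fun q ↦ ‖q.1‖) (4 / 5) (pieceN3 hε hε2 lam μN)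
            (glueBy (fun q ↦ ‖q.1‖) RM (pieceN4 hε hε2 tj δ r₁ r₂ r₃ lam) (pieceM hε hε2 δ lam c))))
        =ᶠ[𝓝 q] pieceN1 hε hε2 cN := by
      have ho : IsOpen {q' : ℂ × ℝ × ℝ | ‖q'.1‖ < 1 / 2} := isOpen_lt hτ continuous_const
      exact eventuallyEq_of_mem (ho.mem_nhds (show ‖q.1‖ < 1 / 2 by linarith)) fun q' hq' ↦ glueBy_of_lt hq'
    exact isLocalDiffeomorphAt_congr_nhds' (isLocalDiffeomorphAt_pieceN1 hε hε2 H.hcN (by linarith) (h1 (by linarith))) hev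
  rcases lt_or_ge ‖q.1‖ (53 / 100) with hB | hB
  · -- the first slab: both pieces agree near `q` at admissible points; admissibility is open
    have hadm := h1 hB
    have ho : IsOpen {q' : ℂ × ℝ × ℝ | 47 / 100 < ‖q'.1‖ ∧ ‖q'.1‖ < 53 / 100 ∧ (cN * q'.2.1) ^ 2 + (cN * q'.2.2) ^ 2 < 1} := by
      refine (isOpen_lt continuous_const hτ).and ((isOpen_lt hτ continuous_const).and ?_)
      exact isOpen_lt (((continuous_const.mul (continuous_fst.comp continuous_snd)).pow 2).add
        ((continuous_const.mul (continuous_snd.comp continuous_snd)).pow 2)) continuous_const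
    have hev : glueBy (fun q : ℂ × ℝ × ℝ ↦ ‖q.1‖) (1 / 2) (pieceN1 hε hε2 cN)
        (glueBy (fun q ↦ ‖q.1‖) (13 / 20) (pieceN2 hε hε2 kapN)
          (glueBy (fun q ↦ ‖q.1‖) (4 / 5) (pieceN3 hε hε2 lam μN)
            (glueBy (fun q ↦ ‖q.1‖) RM (pieceN4 hε hε2 tj δ r₁ r₂ r₃ lam) (pieceM hε hε2 δ lam c))))
        =ᶠ[𝓝 q] pieceN2 hε hε2 kapN := by
      filter_upwards [ho.mem_nhds (show q ∈ {q' : ℂ × ℝ × ℝ | _} from ⟨hA, hB, hadm⟩)] with q' hq'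
      rcases lt_or_ge ‖q'.1‖ (1 / 2) with hl | hr
      · rw [glueBy_of_lt (τ := fun q : ℂ × ℝ × ℝ ↦ ‖q.1‖) hl, A12 q' (abs_lt.2 ⟨by linarith [hq'.1], by linarith⟩) hq'.2.2]
      · rw [glueBy_of_le (τ := fun q : ℂ × ℝ × ℝ ↦ ‖q.1‖) hr,
          glueBy_of_lt (τ := fun q : ℂ × ℝ × ℝ ↦ ‖q.1‖) (show ‖q'.1‖ < 13 / 20 by linarith [hq'.2.1])]
    obtain ⟨hk, hadm2⟩ := h2 hA (by linarith)
    exact isLocalDiffeomorphAt_congr_nhds' (isLocalDiffeomorphAt_pieceN2 hε hε2 H.hkap h0 (hn1 (by linarith)) hk hadm2) hev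
  -- beyond `53/100`: the outer glue of pieces 2, 3, 4, 5 with honest agreement slabs
  have hG : IsLocalDiffeomorphAt 𝓘(ℝ, ℂ × ℝ × ℝ) 𝓘(ℝ, 𝔼 4) ∞
      (glueBy (fun q ↦ ‖q.1‖) (13 / 20) (pieceN2 hε hε2 kapN)
        (glueBy (fun q ↦ ‖q.1‖) (4 / 5) (pieceN3 hε hε2 lam μN)
          (glueBy (fun q ↦ ‖q.1‖) RM (pieceN4 hε hε2 tj δ r₁ r₂ r₃ lam) (pieceM hε hε2 δ lam c)))) q := by
    refine isLocalDiffeomorphAt_glueBy hτ (by norm_num : (0:ℝ) < 3 / 100) (fun q' hq' ↦ ?_) (fun hlt ↦ ?_) (fun hgt ↦ ?_)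
    · rw [A23 q' hq', glueBy_of_lt (τ := fun q : ℂ × ℝ × ℝ ↦ ‖q.1‖) (by have := (abs_lt.1 hq').2; show ‖q'.1‖ < 4 / 5; linarith)]
    · obtain ⟨hk, hadm2⟩ := h2 (by linarith) (by linarith)
      exact isLocalDiffeomorphAt_pieceN2 hε hε2 H.hkap h0 (hn1 (by linarith)) hk hadm2
    · refine isLocalDiffeomorphAt_glueBy hτ (by norm_num : (0:ℝ) < 3 / 100) (fun q' hq' ↦ ?_) (fun hlt' ↦ ?_) (fun hgt' ↦ ?_)
      · rw [A34 q' hq', glueBy_of_lt (τ := fun q : ℂ × ℝ × ℝ ↦ ‖q.1‖)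
          (by have := (abs_lt.1 hq').2; have := H.hRM; show ‖q'.1‖ < RM; linarith)]
      · obtain ⟨hadm3, hb4, hbn, hder⟩ := h3 (by linarith) (by linarith)
        exact isLocalDiffeomorphAt_pieceN3 hε hε2 H.hμ H.hμ01 H.hlam h0 (hn1 (by linarith)) hadm3 hb4 hbn hder
      · refine isLocalDiffeomorphAt_glueBy hτ (by norm_num : (0:ℝ) < 3 / 100) A45 (fun hlt'' ↦ ?_) (fun hgt'' ↦ ?_)
        · exact isLocalDiffeomorphAt_pieceN4 hε hε2 hεπ H.hlam h0 (h4 (by linarith) (by linarith))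
        · obtain ⟨-, -, -, -, -, hcut⟩ := H.far q.1 hgt''
          exact isLocalDiffeomorphAt_pieceM hε hε2 H.hc1 H.hc2 H.hδ H.hδ' H.hlam h0 hcut
  have hev : glueBy (fun q : ℂ × ℝ × ℝ ↦ ‖q.1‖) (1 / 2) (pieceN1 hε hε2 cN)
      (glueBy (fun q ↦ ‖q.1‖) (13 / 20) (pieceN2 hε hε2 kapN)
        (glueBy (fun q ↦ ‖q.1‖) (4 / 5) (pieceN3 hε hε2 lam μN)
          (glueBy (fun q ↦ ‖q.1‖) RM (pieceN4 hε hε2 tj δ r₁ r₂ r₃ lam) (pieceM hε hε2 δ lam c))))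
      =ᶠ[𝓝 q] (glueBy (fun q ↦ ‖q.1‖) (13 / 20) (pieceN2 hε hε2 kapN)
        (glueBy (fun q ↦ ‖q.1‖) (4 / 5) (pieceN3 hε hε2 lam μN)
          (glueBy (fun q ↦ ‖q.1‖) RM (pieceN4 hε hε2 tj δ r₁ r₂ r₃ lam) (pieceM hε hε2 δ lam c)))) := by
    have ho : IsOpen {q' : ℂ × ℝ × ℝ | 1 / 2 < ‖q'.1‖} := isOpen_lt continuous_const hτ
    exact eventuallyEq_of_mem (ho.mem_nhds (show 1 / 2 < ‖q.1‖ by linarith)) fun q' hq' ↦ glueBy_of_le (le_of_lt hq')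
  exact isLocalDiffeomorphAt_congr_nhds' hG hev

end Pieces

end Literature.Topology.FourManifolds
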